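import Summits.Ventures.CertifiedManyBodySolver.Rows.SourcedTorusRowsKKTHook
import Summits.Ventures.CertifiedManyBodySolver.Rows.SourcedTorusRowsOnePointD4
import HarnessLib

/-!
# PINNING-FIELD rows: END TO END — a KKT one-point window certificate IS a response leaf
# `PinFieldResponseFloorAt / CeilingAt`

HONEST FRAMING: first certified bounds on pairing observables; not a superconductivity verdict; every
number certified (two lineages + referee) or labelled float. A response AT FIXED `h > 0` is
symmetry-allowed and says nothing about spontaneous order.

WHAT THIS FILE IS (cell hubbard-cq, D-0082 (c) / LADDER row PC-a, seat hubbard-cq-obsth-1 "pinning-field K5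
menu nodes"; the typed consumer of card `sourced-kkt-one-point-floor`, lead ruling 18:35Z 2026-08-26). ONE identity
in the window algebra `𝔄_{Λ'}` for the objective `Γ(incl)(Φ₀ + Φ₀ᴴ)` — SOS, commutators with the sourced window
Hamiltonian `H^{src,tt'}_{Λ'}`, affine-`D₄` defects over `S ∋ 1` closed under products with `χ_{B₁g} = 1`,
`S^z`-charged words, anti-Hermitian parts, residual words, and a KKT block `kktForm H^{src,tt'}_{Λ'} G (Γ(incl) ∘ B)`
with `G ⪰ 0` and ARBITRARY generators `B_b ∈ 𝔄_Λ` (charged pairs, ODD one-body `αc + βc†`, …); NO cap row —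
with slot `r ≤ c − Σₖ ‖aₖ‖` gives `∃ L₀, PinFieldResponseFloorAt tp U μ h q L₀ (r/2)`: `r/2 ≤ m_L(h)`,
`m_L = dWaveSourceDensityTT' = Re ω₀(Δ_d)/L²`, on every side `L ≥ L₀` with `q ∣ L`
(`pinFieldResponseFloorAt_of_onePoint_window_certificate_kkt`: `Rows/SourcedTorusRowsKKTHook` ⇒ ground-state cell ⇒
`Rows/SourcedTorusRowsOnePointD4` canonical cell ⇒ `Rows/SourcedTorusRowsDensityBridge` leaf); the MAX program
(objective `−Γ(incl)(Φ₀ + Φ₀ᴴ)`) gives the CEILING leaf (`pinFieldResponseCeilingAt_of_onePoint_window_certificate_kkt`).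
In words: «program value `v` for `Re ω(Φ₀ + Φ₀ᴴ)` under these rows ⇒ `m_L(h) ≥ v/2` on every large torus» — read on
by `Observables/PinningFieldMenuReaders` (`.le_liminf`, `.le_pinningFieldPairingOrder`, `.dWaveOrderParameterTT'_le`).

NOTHING IS ASSERTED: identities in, leaves out; no certificate, no number, no `sorry`, no named fact. No definition
(the statements mention no torus-level term; the cells carry their own instances).

References: T. Koma, H. Tasaki, J. Stat. Phys. 76 (1994) 745, §1; M. Araújo et al., arXiv:2311.18707 §3.2
Prop. 11; J. Wang et al., PRX 14 (2024) 031006, §III; O. Bratteli, D. W. Robinson II Prop. 5.3.19, §6.2.4.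
-/

noncomputable section

namespace Summit.Ventures.CertifiedManyBodySolver

open Literature.MathematicalPhysics.QuantumLattice
open Matrix HubbardWave0 Literature.Probability.LatticeModels Finset
open Literature.MathematicalPhysics.QuantumManyBody.StateRelaxation
open Summit.Ventures.CertifiedManyBodySolver.Observables
open scoped BigOperators ComplexOrder

/-! ## §1  End to end: a KKT one-point certificate is a response FLOOR / CEILING leaf -/

section EndToEnd

/-- **A KKT ONE-POINT window certificate is, end to end, a response FLOOR leaf.** The identity of
`re_orbitState_ge_of_sourced_window_certificate_d4_TT'_kkt` for the objective `Γ(incl)(Φ₀ + Φ₀ᴴ)` (the MIN program of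
card `sourced-kkt-one-point-floor`: SOS, commutators with `H^{src,tt'}_{Λ'}`, affine-`D₄` defects over `S ∋ 1` closed
under products with `χ_{B₁g} = 1`, `S^z`-charged words, anti-Hermitian parts, residual words, and a KKT block with
ARBITRARY generators; NO cap row) and a rational slot `r ≤ c − Σₖ ‖aₖ‖` give
`∃ L₀, PinFieldResponseFloorAt tp U μ h q L₀ (r/2)` — `r/2 ≤ m_L(h)` on every side `L ≥ L₀` with `q ∣ L`
(`Observables/PinningFieldChords`; readers `PinFieldResponseFloorAt.le_liminf`, `.le_pinningFieldPairingOrder`).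
[cite: KomaTasaki1994, §1] -/
theorem pinFieldResponseFloorAt_of_onePoint_window_certificate_kkt (tp U μ h : ℝ) {r : ℚ} (q : ℕ)
    {Λ Λ' : Finset (Site 2)} (hΛ : Λ ⊆ Λ') (h8 : thicken Λ 1 ⊆ Λ')
    (h0 : thicken ({0} : Finset (Site 2)) 1 ⊆ Λ') (hz : (0 : Site 2) ∈ Λ')
    (hP : pairRegion (insert (0 : Site 2) unitSteps) 0 ⊆ Λ')
    {S : Finset (DihedralGroup 4)} (h1 : (1 : DihedralGroup 4) ∈ S) (hmul : ∀ a ∈ S, ∀ b ∈ S, a * b ∈ S)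
    (hS : ∀ γ ∈ S, b1gChar γ = 1)
    {m : Type*} [Fintype m] [DecidableEq m] {Λm : Matrix m m ℂ} (hΛm : Λm.PosSemidef)
    (O : m → FermionOp Λ')
    {κ' : Type*} (s : Finset κ') (B : κ' → FermionOp Λ)
    {ι : Type*} (tt : Finset ι) (γ : ι → DihedralGroup 4) (hγS : ∀ l ∈ tt, γ l ∈ S) (wv : ι → Site 2)
    (hsh : ∀ l, d4ShiftSet (γ l) (wv l) Λ ⊆ Λ') (Y : ι → FermionOp Λ)
    {ρ : Type*} (uu : Finset ρ) (b : ρ → ℂ) (cw : ρ → List (Orb (PolySite Λ') × Bool))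
    (hcw : ∀ j ∈ uu, ladderSpinCharge (cw j) ≠ 0)
    {δ : Type*} (ah : Finset δ) (dc : δ → ℝ) (V : δ → FermionOp Λ')
    {κ'' : Type*} (w : Finset κ'') (a : κ'' → ℂ) (word : κ'' → List (Orb (PolySite Λ') × Bool))
    {β : Type*} [Fintype β] [DecidableEq β] {G : Matrix β β ℂ} (hG : G.PosSemidef)
    (Bk : β → FermionOp Λ) {c : ℝ}
    (hcert : fermionEmbed (PolySite.incl hP) onePointPairWord - (c : ℂ) • (1 : FermionOp Λ') =
      gramForm Λm O +
        (∑ k ∈ s, (pairSourceWindowHamiltonianTT' dWaveFormFactor Λ' tp U μ h * fermionEmbed (PolySite.incl hΛ) (B k) -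
            fermionEmbed (PolySite.incl hΛ) (B k) * pairSourceWindowHamiltonianTT' dWaveFormFactor Λ' tp U μ h) +
          ∑ l ∈ tt, (fermionEmbed (PolySite.incl (hsh l)) (fermionEmbed (PolySite.d4Emb (γ l) (wv l) Λ) (Y l)) -
            fermionEmbed (PolySite.incl hΛ) (Y l)) +
          ∑ j ∈ uu, b j • ladderWord (cw j)) +
        (∑ m' ∈ ah, ((dc m' : ℝ) : ℂ) • ((V m')ᴴ - V m') + ∑ k ∈ w, a k • ladderWord (word k)) +
        kktForm (pairSourceWindowHamiltonianTT' dWaveFormFactor Λ' tp U μ h) G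
          (fun b' => fermionEmbed (PolySite.incl hΛ) (Bk b')))
    (hr : ((r : ℚ) : ℝ) ≤ c - ∑ k ∈ w, ‖a k‖) :
    ∃ L₀ : ℕ, PinFieldResponseFloorAt tp U μ h q L₀ (r / 2) := by
  obtain ⟨L₀, hL₀⟩ := SourcedCorrLowerRowGS.of_window_certificate_kkt tp U μ h q hΛ h8 h0 hz hP h1 hmul hS
    (fermionEmbed (PolySite.incl hP) onePointPairWord) hΛm O s B tt γ hγS wv hsh Y uu b cw hcw ah dc V w a word hG Bk
    hcert hr
  obtain ⟨L₀', hL₀'⟩ := hL₀.onePoint_canonical h1 hmul hS hP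
  exact ⟨max L₀' 3, hL₀'.pinFieldResponseFloorAt⟩

/-- **MAX program: a KKT one-point certificate for `−Γ(incl)(Φ₀ + Φ₀ᴴ)` is a response CEILING leaf**
`∃ L₀, PinFieldResponseCeilingAt tp U μ h q L₀ (−r/2)` (`m_L(h) ≤ −r/2`) for `r ≤ c − Σₖ ‖aₖ‖` — the upper cell from the
lower cell of the negated word (`SourcedTorusCorrUpperRowGS.of_lower_neg`). [cite: KomaTasaki1994, §1] -/
theorem pinFieldResponseCeilingAt_of_onePoint_window_certificate_kkt (tp U μ h : ℝ) {r : ℚ} (q : ℕ)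
    {Λ Λ' : Finset (Site 2)} (hΛ : Λ ⊆ Λ') (h8 : thicken Λ 1 ⊆ Λ')
    (h0 : thicken ({0} : Finset (Site 2)) 1 ⊆ Λ') (hz : (0 : Site 2) ∈ Λ')
    (hP : pairRegion (insert (0 : Site 2) unitSteps) 0 ⊆ Λ')
    {S : Finset (DihedralGroup 4)} (h1 : (1 : DihedralGroup 4) ∈ S) (hmul : ∀ a ∈ S, ∀ b ∈ S, a * b ∈ S)
    (hS : ∀ γ ∈ S, b1gChar γ = 1)
    {m : Type*} [Fintype m] [DecidableEq m] {Λm : Matrix m m ℂ} (hΛm : Λm.PosSemidef)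
    (O : m → FermionOp Λ')
    {κ' : Type*} (s : Finset κ') (B : κ' → FermionOp Λ)
    {ι : Type*} (tt : Finset ι) (γ : ι → DihedralGroup 4) (hγS : ∀ l ∈ tt, γ l ∈ S) (wv : ι → Site 2)
    (hsh : ∀ l, d4ShiftSet (γ l) (wv l) Λ ⊆ Λ') (Y : ι → FermionOp Λ)
    {ρ : Type*} (uu : Finset ρ) (b : ρ → ℂ) (cw : ρ → List (Orb (PolySite Λ') × Bool))
    (hcw : ∀ j ∈ uu, ladderSpinCharge (cw j) ≠ 0)
    {δ : Type*} (ah : Finset δ) (dc : δ → ℝ) (V : δ → FermionOp Λ')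
    {κ'' : Type*} (w : Finset κ'') (a : κ'' → ℂ) (word : κ'' → List (Orb (PolySite Λ') × Bool))
    {β : Type*} [Fintype β] [DecidableEq β] {G : Matrix β β ℂ} (hG : G.PosSemidef)
    (Bk : β → FermionOp Λ) {c : ℝ}
    (hcert : -fermionEmbed (PolySite.incl hP) onePointPairWord - (c : ℂ) • (1 : FermionOp Λ') =
      gramForm Λm O +
        (∑ k ∈ s, (pairSourceWindowHamiltonianTT' dWaveFormFactor Λ' tp U μ h * fermionEmbed (PolySite.incl hΛ) (B k) -
            fermionEmbed (PolySite.incl hΛ) (B k) * pairSourceWindowHamiltonianTT' dWaveFormFactor Λ' tp U μ h) +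
          ∑ l ∈ tt, (fermionEmbed (PolySite.incl (hsh l)) (fermionEmbed (PolySite.d4Emb (γ l) (wv l) Λ) (Y l)) -
            fermionEmbed (PolySite.incl hΛ) (Y l)) +
          ∑ j ∈ uu, b j • ladderWord (cw j)) +
        (∑ m' ∈ ah, ((dc m' : ℝ) : ℂ) • ((V m')ᴴ - V m') + ∑ k ∈ w, a k • ladderWord (word k)) +
        kktForm (pairSourceWindowHamiltonianTT' dWaveFormFactor Λ' tp U μ h) G
          (fun b' => fermionEmbed (PolySite.incl hΛ) (Bk b')))
    (hr : ((r : ℚ) : ℝ) ≤ c - ∑ k ∈ w, ‖a k‖) :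
    ∃ L₀ : ℕ, PinFieldResponseCeilingAt tp U μ h q L₀ (-r / 2) := by
  obtain ⟨L₀, hL₀⟩ := SourcedCorrLowerRowGS.of_window_certificate_kkt tp U μ h q hΛ h8 h0 hz hP h1 hmul hS
    (-fermionEmbed (PolySite.incl hP) onePointPairWord) hΛm O s B tt γ hγS wv hsh Y uu b cw hcw ah dc V w a word hG Bk
    hcert hr
  have hup : SourcedCorrUpperRowGS tp U μ h q L₀ (-r) Λ' S (fermionEmbed (PolySite.incl hP) onePointPairWord) :=
    fun L _ hInj' hL hqL => SourcedTorusCorrUpperRowGS.of_lower_neg (by rw [neg_neg]; exact hL₀ L hInj' hL hqL)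
  obtain ⟨L₀', hL₀'⟩ := hup.onePoint_canonical h1 hmul hS hP
  exact ⟨max L₀' 3, hL₀'.pinFieldResponseCeilingAt⟩

end EndToEnd

end Summit.Ventures.CertifiedManyBodySolver

end
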